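import HarnessLib
import Summits.Ventures.WeilGRH.UniformConductorFloorPrincipal
import Summits.Ventures.WeilGRH.OneCompleteMod19Even
import Summits.Ventures.WeilGRH.DualTrigMod19OddOne

/-!
# GRH arm (rh-explicit, venture WeilGRH): Weil positivity on `[−1, 1]` for EVERY non-principal Dirichlet character mod 19 — the complete level 19

Cell `rh-explicit`, WEIL TRACK — GRH ARM (seat weil-grh-1 gen12; pure assembly of two landed halves):
* EVEN non-principal characters mod 19: `OneCompleteMod19Even.weilPositivityOnChar_mod19_one_of_even` (weil-grh-2's door-C χ-cells and real islands);
* ODD characters mod 19: `weilPositivityOnChar_mod19_one_of_odd` (weil-grh-3's format-D-K lattice certificates, one per class, `DualTrigMod19OddOne`).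
Since `19 ∈ F` (the principal character FAILS on `[−1, 1]` by weil-grh-1's flat-window witness `UniformFloor.not_weilPositivityOnChar_one_principal`),
the level is decided exactly: `WeilPositivityOnChar χ 1 ↔ χ ≠ 1`.  Pure assembly; RH/GRH-free; standard axioms.
-/

noncomputable section

namespace Summit.Ventures.WeilGRH.OneCompleteMod19All
open Literature.NumberTheory.LFunctions

/-- ★★ **Every non-principal Dirichlet character mod 19 satisfies Weil positivity on `[−1, 1]`.**
[cite: Weil1952FormulesExplicites, (11) pp. 261–262 and the «lemme» p. 262] -/
theorem weilPositivityOnChar_mod19_one (χ : DirichletCharacter ℂ 19) (hχ : χ ≠ 1) : WeilPositivityOnChar χ 1 := by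
  rcases χ.even_or_odd with he | ho
  · exact OneCompleteMod19Even.weilPositivityOnChar_mod19_one_of_even χ hχ he
  · exact weilPositivityOnChar_mod19_one_of_odd χ ho

/-- ★★ **At level 19 EXACTLY the principal character fails Weil positivity on `[−1, 1]`**: for every Dirichlet character `χ` mod 19,
`WeilPositivityOnChar χ 1 ↔ χ ≠ 1`. [cite: Weil1952FormulesExplicites, (11) pp. 261–262 and the «lemme» p. 262] -/
theorem weilPositivityOnChar_one_iff_ne_one_mod19 (χ : DirichletCharacter ℂ 19) : WeilPositivityOnChar χ 1 ↔ χ ≠ 1 :=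
  ⟨fun h h1 ↦ UniformFloor.not_weilPositivityOnChar_one_principal (q := 19) (by decide) (h1 ▸ h), weilPositivityOnChar_mod19_one χ⟩

/-- Every non-principal character mod 19 is Weil-positive on every window `[−t, t]`, `t ≤ 1`. [folklore] -/
theorem weilPositivityOnChar_of_le_one_mod19 (χ : DirichletCharacter ℂ 19) (hχ : χ ≠ 1) {t : ℝ} (ht : t ≤ 1) :
    WeilPositivityOnChar χ t := fun g hg hsupp ↦
  weilPositivityOnChar_mod19_one χ hχ g hg (hsupp.trans (Set.Icc_subset_Icc (by linarith) ht))

end Summit.Ventures.WeilGRH.OneCompleteMod19All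

end
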